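import Summits.ABC.ABC.Theses.CubicResolventAllowance
import Literature.NumberTheory.CubicFields.MaximalCubicRings
import HarnessLib

/-!
# Stub-ideation k=2 (RESHAPE), GEN 3 — `stub_realCubic` of crux `IndexSzpiro` (stmt-ABC-22740)

Builds on gen 2 (`Cruxes/IndexSzpiro/StubIdeas2Sketch.lean`, ns `…StubIdeas2`: the universal family
`curveOfForm F u v`, CORE A = `IndexFormSzpiroReal`, `assemblyT`, `polySzpiro_of_stub`; that module is
not importable on the farm, so the five declarations used here are MIRRORED verbatim in §0).
New in gen 3 — §F, §L, §M are PROVED (no `sorry`); `sorry` only in §T (`prop_*` = PROPOSALS):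

* §F FRAME NORMALISATION — for coprime `(u,v)` pick `γ ∈ SL₂(ℤ)` with first row `(u,v)`; then
  `(F∘γ).a = F(u,v)`, `P(F∘γ) = H_F(u,v)`, `Disc(F∘γ) = Disc F`, maximality transports: every local
  question about the point `(u,v)` becomes a CONGRUENCE on the coefficients of `F∘γ` (this is how
  Bennett–Gherga–Rechnitzer work: `F(1,0) = ∏ p^{κ_p}`, Math. Comp. 88 (2019) Thm 1 / §4).
* §L `L0`: `p ∣ F(u,v) ∧ p ∣ H_F(u,v) ⟹ p ∣ Disc F` (`Disc ∈ (a,b)`); `L1`: for MAXIMAL `F` moreover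
  `p² ∤ F(u,v)` (the Davenport–Heilbronn `U_p` condition read at `(1:0)`); `T3′`: hence for `p ≥ 5`
  `¬(p² ∣ H ∧ p³ ∣ G)` — twist-minimality AND Kraus-minimality of `E_{F,u,v}` by pure arithmetic
  (replaces the `η/p ∈ 𝓞_K` integrality transport of gen-2 `helperT3_twistMinimal`).
* §M LEADING-COEFFICIENT SZPIRO `⟺` CORE A (the `(u,v)`-quantifier is eliminated by the group action).
* §T the CLOSED LOCAL TYPE TABLE at `p ≥ 5` (corollaries typed over `curveOfForm`, proposals).
-/

open Polynomial NumberField WeierstrassCurve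
open Literature.NumberTheory.CubicFields Literature.NumberTheory.CubicFields.BinaryCubic

namespace Summit.ABC.ABC.Cruxes.IndexSzpiro.StubIdeas2RealG3

/-! ## §0 Mirrors of gen-2 declarations (verbatim from `StubIdeas2Sketch.lean`) -/

/-- The stub, verbatim (registered skeleton `line2-birth.lean`, `stub_realCubic`). -/
def StubRealCubic : Prop :=
  ∀ ε : ℝ, 0 < ε → ∃ C : ℝ, ∀ (W : WeierstrassCurve ℚ) [W.IsElliptic] (K : Type) [Field K] [NumberField K],
    Irreducible W.twoTorsionPolynomial.toPoly → Module.finrank ℚ K = 3 →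
    (∃ θ : K, aeval θ W.twoTorsionPolynomial.toPoly = 0) → 0 < NumberField.discr K →
    (W.minimalDiscriminantNorm ℤ : ℝ) ≤ C * |(NumberField.discr K : ℝ)| * (W.conductorNorm ℤ : ℝ) ^ (6 + ε)

/-- Mirror of `BinaryCubic.hessianEval`: `H_F(u,v) = P u² + Q uv + R v²`. -/
def hessEval (F : BinaryCubic ℤ) (u v : ℤ) : ℤ :=
  (F.b ^ 2 - 3 * F.a * F.c) * u ^ 2 + (F.b * F.c - 9 * F.a * F.d) * u * v + (F.c ^ 2 - 3 * F.b * F.d) * v ^ 2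

/-- Mirror of `BinaryCubic.jacobianEval`: `G_F = F_u·H_v − F_v·H_u`. -/
def jacEval (F : BinaryCubic ℤ) (u v : ℤ) : ℤ :=
  (3 * F.a * u ^ 2 + 2 * F.b * u * v + F.c * v ^ 2) *
      ((F.b * F.c - 9 * F.a * F.d) * u + 2 * (F.c ^ 2 - 3 * F.b * F.d) * v) -
    (F.b * u ^ 2 + 2 * F.c * u * v + 3 * F.d * v ^ 2) *
      (2 * (F.b ^ 2 - 3 * F.a * F.c) * u + (F.b * F.c - 9 * F.a * F.d) * v)

/-- The syzygy `G² = 4H³ − 27·Disc·F²` (mirror of `BinaryCubic.jacobianEval_sq`). -/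
theorem jacEval_sq (F : BinaryCubic ℤ) (u v : ℤ) :
    jacEval F u v ^ 2 = 4 * hessEval F u v ^ 3 - 27 * F.disc * F.eval u v ^ 2 := by
  simp only [jacEval, hessEval, disc_eq, BinaryCubic.eval]; ring

/-- The universal family of the class (gen 2): `E_{F,u,v} : y² = x³ − 27 H_F(u,v) x − 27 G_F(u,v)`
(`c₄ = 1296 H`, `c₆ = 23328 G`, `Δ = 2⁴3¹²·Disc F·F(u,v)²`; `(gu,gv)` = quadratic twist by `g`). -/
def curveOfForm (F : BinaryCubic ℤ) (u v : ℤ) : WeierstrassCurve ℤ :=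
  ⟨0, 0, 0, -27 * hessEval F u v, -27 * jacEval F u v⟩

/-- The `5`-rough conductor proxy (gen 2): `∏_{p ≥ 5, p ∣ Disc F·F(u,v)} p^(1 + [p ∣ H_F(u,v)])`. -/
noncomputable def conductorProxy (F : BinaryCubic ℤ) (u v : ℤ) : ℕ :=
  ∏ p ∈ ((F.disc * F.eval u v).natAbs.primeFactors.filter (fun p => 5 ≤ p)),
    p ^ (if (p : ℤ) ∣ hessEval F u v then 2 else 1)

/-- CORE A (gen 2, OPEN): index-form Szpiro for totally real cubic fields. -/
def IndexFormSzpiroReal : Prop :=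
  ∀ ε : ℝ, 0 < ε → ∃ C : ℝ, ∀ F : BinaryCubic ℤ, F.IsIrreducible → RingOfForm.IsMaximal F → 0 < F.disc →
    ∀ u v : ℤ, IsCoprime u v →
      |((F.eval u v : ℤ) : ℝ)| ≤ C * (conductorProxy F u v : ℝ) ^ (3 + ε)



variable (F : BinaryCubic ℤ)

/-! ## §F Frame normalisation (all proved) -/

/-- Bezout frame: a coprime ROW `(u,v)` is the first row of some `γ ∈ SL₂(ℤ)`. -/
theorem exists_sl2_row {u v : ℤ} (h : IsCoprime u v) :
    ∃ γ : Matrix (Fin 2) (Fin 2) ℤ, γ.det = 1 ∧ γ 0 0 = u ∧ γ 0 1 = v := by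
  obtain ⟨x, y, hxy⟩ := h
  refine ⟨!![u, v; -y, x], ?_, by simp, by simp⟩
  simp [Matrix.det_fin_two]
  linear_combination hxy

/-- A `det = 1` substitution is a `GL₂(ℤ)`-equivalence (the twist is trivial). -/
theorem gl2zEquiv_subst {γ : Matrix (Fin 2) (Fin 2) ℤ} (h : γ.det = 1) : GL2ZEquiv F (F.subst γ) :=
  ⟨γ, by rw [h]; exact isUnit_one, by simp [twist, h]⟩

/-- FRAME IDENTITY 1: the leading coefficient of `F∘γ` is the VALUE of `F` at the first row. -/
theorem subst_a (γ : Matrix (Fin 2) (Fin 2) ℤ) : (F.subst γ).a = F.eval (γ 0 0) (γ 0 1) := by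
  simp only [subst, BinaryCubic.eval]

/-- Covariance of the (mirrored) Hessian: `H(F∘γ)(u,v) = det² · H_F((u,v)γ)`. -/
theorem hessEval_subst (γ : Matrix (Fin 2) (Fin 2) ℤ) (u v : ℤ) :
    hessEval (F.subst γ) u v =
      γ.det ^ 2 * hessEval F (u * γ 0 0 + v * γ 1 0) (u * γ 0 1 + v * γ 1 1) := by
  simp only [hessEval, subst, Matrix.det_fin_two]; ring

/-- FRAME IDENTITY 2: `P(F∘γ) = b'² − 3a'c' = det² · H_F(first row)`. -/
theorem hessP_frame (γ : Matrix (Fin 2) (Fin 2) ℤ) :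
    (F.subst γ).b ^ 2 - 3 * (F.subst γ).a * (F.subst γ).c = γ.det ^ 2 * hessEval F (γ 0 0) (γ 0 1) := by
  simp only [hessEval, subst, Matrix.det_fin_two]; ring

/-- FRAME IDENTITY 3: the conductor proxy of gen 2 is frame-invariant (`det γ = 1`). -/
theorem conductorProxy_frame {γ : Matrix (Fin 2) (Fin 2) ℤ} (hdet : γ.det = 1) :
    conductorProxy (F.subst γ) 1 0 = conductorProxy F (γ 0 0) (γ 0 1) := by
  have h1 : (F.subst γ).disc = F.disc := by rw [disc_subst, hdet, one_pow, one_mul]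
  have h2 : (F.subst γ).eval 1 0 = F.eval (γ 0 0) (γ 0 1) := by rw [eval_subst]; simp
  have h3 : hessEval (F.subst γ) 1 0 = hessEval F (γ 0 0) (γ 0 1) := by rw [hessEval_subst, hdet]; simp
  simp only [conductorProxy, h1, h2, h3]

/-! ## §L The two congruence lemmas and twist-minimality (all proved) -/

/-- `Disc F ∈ (a, b) ⊂ ℤ[a,b,c,d]`. -/
theorem disc_eq_b_mul_add_a_mul : F.disc =
    F.b * (F.b * F.c ^ 2 - 4 * F.b ^ 2 * F.d + 18 * F.a * F.c * F.d) + F.a * (-4 * F.c ^ 3 - 27 * F.a * F.d ^ 2) := by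
  rw [disc_eq]; ring

/-- L0 in the frame: `p ∣ a`, `p ∣ P = b² − 3ac` ⟹ `p ∣ b` and `p ∣ Disc`. -/
theorem dvd_b_dvd_disc_of_dvd_a {p : ℤ} (hp : Prime p) (ha : p ∣ F.a) (hP : p ∣ F.b ^ 2 - 3 * F.a * F.c) :
    p ∣ F.b ∧ p ∣ F.disc := by
  have h3 : p ∣ 3 * F.a * F.c := (Dvd.dvd.mul_left ha 3).mul_right _
  have hb2 : p ∣ F.b ^ 2 := by have h := dvd_add hP h3; rwa [sub_add_cancel] at h
  have hb : p ∣ F.b := hp.dvd_of_dvd_pow hb2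
  exact ⟨hb, by rw [disc_eq_b_mul_add_a_mul]; exact dvd_add (hb.mul_right _) (ha.mul_right _)⟩

/-- **L0** (frame-free): a common zero of `F` and its Hessian mod `p` at a primitive point forces
`p ∣ Disc F` — "additive ⊆ ramified" on the form side. No maximality needed; every prime `p`. -/
theorem dvd_disc_of_dvd_eval_of_dvd_hessEval {p : ℤ} (hp : Prime p) {u v : ℤ} (huv : IsCoprime u v)
    (hF : p ∣ F.eval u v) (hH : p ∣ hessEval F u v) : p ∣ F.disc := by
  obtain ⟨γ, hdet, h0, h1⟩ := exists_sl2_row huv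
  have ha : p ∣ (F.subst γ).a := by rw [subst_a, h0, h1]; exact hF
  have hP : p ∣ (F.subst γ).b ^ 2 - 3 * (F.subst γ).a * (F.subst γ).c := by
    rw [hessP_frame, hdet, h0, h1, one_pow, one_mul]; exact hH
  have h := (dvd_b_dvd_disc_of_dvd_a (F.subst γ) hp ha hP).2
  rwa [disc_subst, hdet, one_pow, one_mul] at h

/-- L1 in the frame: `F ∈ U_p`, `p ∣ a`, `p ∣ P` ⟹ `p² ∤ a` (definition of `U_p` with `g = F`). -/
theorem not_sq_dvd_a_of_memU {p : ℕ} (hp : p.Prime) (hU : F.MemU p) (ha : (p : ℤ) ∣ F.a)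
    (hP : (p : ℤ) ∣ F.b ^ 2 - 3 * F.a * F.c) : ¬ (p : ℤ) ^ 2 ∣ F.a := fun h2 =>
  hU.2 ⟨F, GL2ZEquiv.refl F, h2, (dvd_b_dvd_disc_of_dvd_a F (Nat.prime_iff_prime_int.mp hp) ha hP).1⟩

/-- **L1** (frame-free): `F` MAXIMAL, `(u,v)` coprime, `p ∣ F(u,v)`, `p ∣ H_F(u,v)` ⟹ `p² ∤ F(u,v)`:
at a double-root hit the index-form value is EXACTLY divisible by `p` (= BeGhRe Thm 1 (11),
`κ_p ∈ {0,1}` at additive `p`, proved there via Tate's algorithm; here from `U_p` in three lines). -/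
theorem not_sq_dvd_eval (hmax : RingOfForm.IsMaximal F) {p : ℕ} (hp : p.Prime) {u v : ℤ}
    (huv : IsCoprime u v) (hF : (p : ℤ) ∣ F.eval u v) (hH : (p : ℤ) ∣ hessEval F u v) :
    ¬ (p : ℤ) ^ 2 ∣ F.eval u v := by
  obtain ⟨γ, hdet, h0, h1⟩ := exists_sl2_row huv
  have hU : (F.subst γ).MemU p :=
    (RingOfForm.memU_of_isMaximal hmax hp.one_lt).of_gl2zEquiv (gl2zEquiv_subst F hdet)
  have hav : (F.subst γ).a = F.eval u v := by rw [subst_a, h0, h1]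
  have hP : (p : ℤ) ∣ (F.subst γ).b ^ 2 - 3 * (F.subst γ).a * (F.subst γ).c := by
    rw [hessP_frame, hdet, h0, h1, one_pow, one_mul]; exact hH
  have h := not_sq_dvd_a_of_memU (F.subst γ) hp hU (by rw [hav]; exact hF) hP
  rwa [hav] at h

/-- **T3′** (twist-minimality of primitive points at `p ≥ 5`, by arithmetic): `F` maximal, `(u,v)`
coprime, `p ≥ 5`, `p³ ∤ Disc F` (tree: `RingOfForm.IsMaximal.not_pow_dvd_disc`, module
`MaximalDiscriminantValuation`, not importable on the farm today — hence a hypothesis) ⟹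
`¬(p² ∣ H(u,v) ∧ p³ ∣ G(u,v))`. Proof: syzygy `27·Disc·F² = 4H³ − G²` gives `p⁶ ∣ 27·Disc·F(u,v)²`;
if `p ∤ F(u,v)` then `p⁶ ∣ Disc`; else L0 + L1 give `p ∥ F(u,v)`, so `p³ ∣ Disc/p·…` — contradiction.
A fortiori the model `curveOfForm F u v` is Kraus-minimal at `p` (`¬(p⁴ ∣ c₄ ∧ p⁶ ∣ c₆)`). -/
theorem not_twistDivisible (hmax : RingOfForm.IsMaximal F) {p : ℕ} (hp : p.Prime) (h5 : 5 ≤ p)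
    (hD3 : ¬ (p : ℤ) ^ 3 ∣ F.disc) {u v : ℤ} (huv : IsCoprime u v) :
    ¬ ((p : ℤ) ^ 2 ∣ hessEval F u v ∧ (p : ℤ) ^ 3 ∣ jacEval F u v) := by
  rintro ⟨hH, hG⟩
  have hp' : Prime (p : ℤ) := Nat.prime_iff_prime_int.mp hp
  have hH1 : (p : ℤ) ∣ hessEval F u v := (dvd_pow_self _ two_ne_zero).trans hH
  have h27 : ¬ (p : ℤ) ∣ 27 := by
    intro h
    have h3 : (p : ℤ) ∣ 3 := hp'.dvd_of_dvd_pow (n := 3) (by norm_num; exact h)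
    have := Int.le_of_dvd (by norm_num) h3
    have : (5 : ℤ) ≤ p := by exact_mod_cast h5
    omega
  -- the syzygy makes `27·Disc·F²` divisible by `p⁶`
  have h6 : (p : ℤ) ^ 6 ∣ 27 * F.disc * F.eval u v ^ 2 := by
    have e : 27 * F.disc * F.eval u v ^ 2 = 4 * hessEval F u v ^ 3 - jacEval F u v ^ 2 := by
      linear_combination jacEval_sq F u v
    rw [e]
    obtain ⟨k, hk⟩ := hH
    obtain ⟨m, hm⟩ := hG
    exact ⟨4 * k ^ 3 - m ^ 2, by rw [hk, hm]; ring⟩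
  by_cases hFp : (p : ℤ) ∣ F.eval u v
  · have hD := dvd_disc_of_dvd_eval_of_dvd_hessEval F hp' huv hFp hH1
    have hF2 := not_sq_dvd_eval F hmax hp huv hFp hH1
    obtain ⟨m, hm⟩ := hFp
    have hpm : ¬ (p : ℤ) ∣ m := by
      rintro ⟨k, rfl⟩
      exact hF2 ⟨k, by rw [hm]; ring⟩
    obtain ⟨D₁, hD₁⟩ := hD
    have key : (p : ℤ) ^ 3 * (p : ℤ) ^ 3 ∣ (p : ℤ) ^ 3 * (27 * D₁ * m ^ 2) := by
      have e : 27 * F.disc * F.eval u v ^ 2 = (p : ℤ) ^ 3 * (27 * D₁ * m ^ 2) := by rw [hD₁, hm]; ring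
      rw [← e, ← pow_add]; exact h6
    have hp0 : (p : ℤ) ^ 3 ≠ 0 := pow_ne_zero _ hp'.ne_zero
    have key' : (p : ℤ) ^ 3 ∣ 27 * D₁ * m ^ 2 := (mul_dvd_mul_iff_left hp0).mp key
    have hm2 : ¬ (p : ℤ) ∣ m ^ 2 := fun h => hpm (hp'.dvd_of_dvd_pow h)
    have h3 : (p : ℤ) ^ 3 ∣ 27 * D₁ := hp'.pow_dvd_of_dvd_mul_right 3 hm2 key'
    have h4 : (p : ℤ) ^ 3 ∣ D₁ := hp'.pow_dvd_of_dvd_mul_left 3 h27 h3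
    obtain ⟨k, hk⟩ := h4
    exact hD3 ⟨(p : ℤ) * k, by rw [hD₁, hk]; ring⟩
  · have hF2' : ¬ (p : ℤ) ∣ F.eval u v ^ 2 := fun h => hFp (hp'.dvd_of_dvd_pow h)
    have h3 : (p : ℤ) ^ 6 ∣ 27 * F.disc := hp'.pow_dvd_of_dvd_mul_right 6 hF2' h6
    have h4 : (p : ℤ) ^ 6 ∣ F.disc := hp'.pow_dvd_of_dvd_mul_left 6 h27 h3
    exact hD3 ((pow_dvd_pow _ (by norm_num)).trans h4)

/-! ## §M Leading-coefficient Szpiro = CORE A (quantifier elimination of the point; proved) -/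

/-- LEADING-COEFFICIENT SZPIRO for maximal real cubic forms: `|a| ≤ C(ε)·proxy(F,(1,0))^{3+ε}` —
the stub's Diophantine core with the point FIXED at `(1:0)` and the form ranging over whole
`GL₂(ℤ)`-orbits (BeGhRe's normalisation `F(1,0) = ∏ p^{κ_p}`). -/
def LeadingCoeffSzpiroReal : Prop :=
  ∀ ε : ℝ, 0 < ε → ∃ C : ℝ, ∀ F : BinaryCubic ℤ, F.IsIrreducible → RingOfForm.IsMaximal F → 0 < F.disc →
    |((F.a : ℤ) : ℝ)| ≤ C * (conductorProxy F 1 0 : ℝ) ^ (3 + ε)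

/-- `LeadingCoeffSzpiroReal ⟺ IndexFormSzpiroReal` (CORE A): `←` is the point `(1,0)`; `→` moves a
coprime point to `(1,0)` by `exists_sl2_row` and transports irreducibility
(`GL2ZEquiv.isIrreducible_iff`), maximality (`IsMaximal.of_gl2zEquiv`), `Disc` (`disc_subst`),
the value (`subst_a`) and the proxy (`conductorProxy_frame`). -/
theorem leadingCoeff_iff_indexForm : LeadingCoeffSzpiroReal ↔ IndexFormSzpiroReal := by
  constructor
  · intro h ε hε
    obtain ⟨C, hC⟩ := h ε hε
    refine ⟨C, fun F hirr hmax hd u v huv => ?_⟩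
    obtain ⟨γ, hdet, h0, h1⟩ := exists_sl2_row huv
    have he : GL2ZEquiv F (F.subst γ) := gl2zEquiv_subst F hdet
    have hd' : 0 < (F.subst γ).disc := by rw [disc_subst, hdet, one_pow, one_mul]; exact hd
    have key := hC (F.subst γ) (he.isIrreducible_iff.mp hirr) (hmax.of_gl2zEquiv he) hd'
    rwa [subst_a, conductorProxy_frame F hdet, h0, h1] at key
  · intro h ε hε
    obtain ⟨C, hC⟩ := h ε hε
    refine ⟨C, fun F hirr hmax hd => ?_⟩
    have key := hC F hirr hmax hd 1 0 isCoprime_one_left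
    have ha : F.eval 1 0 = F.a := by simp [BinaryCubic.eval]
    rwa [ha] at key

/-! ## §T The closed local type table at `p ≥ 5` (PROPOSALS — `sorry` = work for the stub prover)

For `F` maximal irreducible, `(u,v)` coprime, `p ≥ 5`, `E = curveOfForm F u v` (twist-minimal and
minimal at `p` by `T3′`), with `n_p = v_p(Δ_min) = v_p(Disc F) + 2·v_p(F(u,v))` (gen-2 T4) and
`f_p = [p ∣ Δ]·(1 + [p ∣ H_F(u,v)])` (gen-2 T5):

| `v_p(Disc F)` | `(u:v) mod p`        | type        | `f_p` | `n_p`                      |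
|---------------|----------------------|-------------|-------|----------------------------|
| 0             | not a root of `F`    | good        | 0     | 0                          |
| 0             | (simple) root        | `I_{2k}`    | 1     | `2k`, `k = v_p(F(u,v)) ≥ 1` |
| 1             | not a root           | `I_1`       | 1     | 1                          |
| 1             | the simple root      | `I_{1+2k}`  | 1     | `1 + 2k`                   |
| 1             | the double root      | III         | 2     | 3  (`k = 1` forced by L1)  |
| 2             | not the root         | II          | 2     | 2                          |
| 2             | the triple root      | IV          | 2     | 4  (`k = 1` forced by L1)  |

(`p ∣ H_F(u,v)` iff `(u:v)` is a multiple root of `F mod p`, or `p² ∣ Disc F` where `H ≡ 0`; L0 closes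
the table: `p ∣ F(u,v) ∧ p ∣ H ⟹ p ∣ Disc`.)  Regression: kit job j344464 rows Td/Te. -/

variable {F}

/-- TABLE COROLLARY 1 (ADD ⊆ RAM): an additive prime `p ≥ 5` of a twist-minimal member divides `d_K`.
Route: `p² ∣ N ⟹ p ∣ c₄ = 1296·H(u,v)` and `p ∣ Δ = 2⁴3¹²·Disc·F(u,v)²` (gen-2 T5) `⟹` L0. -/
theorem prop_additive_dvd_disc (hmax : RingOfForm.IsMaximal F) (hirr : F.IsIrreducible) (hd : 0 < F.disc)
    {u v : ℤ} (huv : IsCoprime u v) [((curveOfForm F u v).baseChange ℚ).IsElliptic]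
    {p : ℕ} (hp : p.Prime) (h5 : 5 ≤ p)
    (hadd : p ^ 2 ∣ ((curveOfForm F u v).baseChange ℚ).conductorNorm ℤ) : (p : ℤ) ∣ F.disc := by
  sorry

/-- TABLE COROLLARY 2 (additive exponents are tiny): additive at `p ≥ 5` ⟹ `v_p(Δ_min) = v_p(Disc F) + 2 ≤ 4`
(gen-2 T4 + L1 + `v_p(Disc) ≤ 2`). -/
theorem prop_additive_ordDisc_le (hmax : RingOfForm.IsMaximal F) (hirr : F.IsIrreducible) (hd : 0 < F.disc)
    {u v : ℤ} (huv : IsCoprime u v) [((curveOfForm F u v).baseChange ℚ).IsElliptic]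
    {p : ℕ} (hp : p.Prime) (h5 : 5 ≤ p)
    (hadd : p ^ 2 ∣ ((curveOfForm F u v).baseChange ℚ).conductorNorm ℤ) :
    (((curveOfForm F u v).baseChange ℚ).minimalDiscriminantNorm ℤ).factorization p ≤ 4 := by
  sorry

/-- TABLE COROLLARY 3 (PARITY / index towers): at `p ∤ Disc F`, `p ≥ 5`, `p ∣ F(u,v)` the reduction is
multiplicative (`p ∥ N`) and `v_p(Δ_min) = 2·v_p(F(u,v))` is EVEN (gen-2 T4/T5 with `g = 1`, L0). -/
theorem prop_unramified_tower (hmax : RingOfForm.IsMaximal F) (hirr : F.IsIrreducible) (hd : 0 < F.disc)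
    {u v : ℤ} (huv : IsCoprime u v) [((curveOfForm F u v).baseChange ℚ).IsElliptic]
    {p : ℕ} (hp : p.Prime) (h5 : 5 ≤ p) (hpD : ¬ (p : ℤ) ∣ F.disc) (hpF : (p : ℤ) ∣ F.eval u v) :
    p ∣ ((curveOfForm F u v).baseChange ℚ).conductorNorm ℤ ∧
      ¬ p ^ 2 ∣ ((curveOfForm F u v).baseChange ℚ).conductorNorm ℤ ∧
      (((curveOfForm F u v).baseChange ℚ).minimalDiscriminantNorm ℤ).factorization p =
        2 * (F.eval u v).natAbs.factorization p := by
  sorry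

/-- ASSEMBLY (gen 2, unchanged): CORE A ⟹ the stub; with §M one may equally start from
`LeadingCoeffSzpiroReal`. -/
theorem assembly (h : LeadingCoeffSzpiroReal) : StubRealCubic := by
  have hA : IndexFormSzpiroReal := leadingCoeff_iff_indexForm.mp h
  sorry

/-! ## In-Lean regression: the frame of the census point `(24,5)` on `F₀ = u³+u²v−2uv²−v³` (`Disc = 49`) -/

/-- `γ = (24 5; 19 4) ∈ SL₂(ℤ)` and `F₀∘γ = (7·13³, 7·5218, 7·4131, 7631)`: `7 ∣ a', b', c'`, `7 ∤ d'`,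
`7² ∤ a'` (L1: `(24:5)` is the triple root `2` of `F₀ mod 7`; type IV, `n₇ = 2 + 2 = 4`, `f₇ = 2`), and
`13 ∣ a'`, `13 ∤ b'` (unramified simple root: `I₆`, `n₁₃ = 6`, `f₁₃ = 1`) — census `N = 2²·7²·13`. -/
example : (!![24, 5; 19, 4] : Matrix (Fin 2) (Fin 2) ℤ).det = 1 := by norm_num [Matrix.det_fin_two]
example : ((⟨1, 1, -2, -1⟩ : BinaryCubic ℤ).subst !![24, 5; 19, 4]).a = 7 * 13 ^ 3 ∧
    ((⟨1, 1, -2, -1⟩ : BinaryCubic ℤ).subst !![24, 5; 19, 4]).b = 7 * 5218 ∧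
    ((⟨1, 1, -2, -1⟩ : BinaryCubic ℤ).subst !![24, 5; 19, 4]).c = 7 * 4131 ∧
    ((⟨1, 1, -2, -1⟩ : BinaryCubic ℤ).subst !![24, 5; 19, 4]).d = 7631 := by
  simp only [subst]; norm_num
example : ¬ (7 : ℤ) ∣ 7631 ∧ ¬ (13 : ℤ) ∣ 7 * 5218 ∧ ¬ (7 : ℤ) ^ 2 ∣ 7 * 13 ^ 3 := by decide

end Summit.ABC.ABC.Cruxes.IndexSzpiro.StubIdeas2RealG3
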